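import Mathlib
import HarnessLib
import Summits.Ventures.LatticeQCDFlow.Scoring.RegenerativeMedianOfGroupsSigma
import Summits.Ventures.LatticeQCDFlow.Scoring.RegenerativeVarianceEstimatorPlugIn

/-!
# The regenerative chapter in one statement: every exact sampler with a minorisation
# `K(x, ·) ≥ ε ν` admits a coin-augmentation whose state path IS the sampler's path and whose tours
# certify error bars at the scale of the asymptotic variance — from any start, CLT-free

HONEST FRAMING: exact (Metropolis-corrected) sampling algorithms for lattice gauge theory;
figures of merit are autocorrelation/cost numbers at stated couplings and volumes; no
continuum-physics claim.

Venture `LatticeQCDFlow` (cell pub-lqcd), topic `Scoring`; FANOUT row 8 (`s0-cpn-nemc`, GEN-17).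
NEW WORK of the cell, not a published result; no definition is introduced.  A quotable packaging of
GEN-15…17 (`Scoring/SplitChain.lean` … `Scoring/RegenerativeMedianOfGroupsSigma.lean`): for a Markov
kernel `κ` with invariant probability law `π` and a minorisation `κ(x, ·) ≥ ε ν` by ANY probability
law `ν`, `0 < ε < 1`, there EXISTS a Markov kernel `κ̂` on `Ω × Bool` (a split kernel) such that
(i) for every initial law `μ̂₀` on `Ω × Bool` the state path of the `κ̂`-chain has EXACTLY the law of
the `κ`-chain from `μ̂₀.map fst` (so nothing about the sampler changes); and, writing
`σ²_f = Var_π f + 2 Σ_{k≥1} C_f(k)` for the Green–Kubo asymptotic variance of a bounded measurable `f`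
and building tours from the coin coordinate: (ii) `P(s ≤ |Â_R − π(f)|) ≤ 4(ε σ²_f/s² + 1 − ε)/R`;
(iii) `4(ε σ²_f/s² + 1 − ε)/m ≤ 1/4 ⇒ P(#{bad groups among K} ≥ K/2) ≤ e^{−K/8}`; (iv) the plug-in
regenerative variance estimator is consistent at the explicit rate of
`Scoring/RegenerativeVarianceEstimatorPlugIn.lean` — all from ANY initial law.  For independence
samplers the coins are moreover implementable (`Scoring/IndepMHRetrospectiveCoins*.lean`).  Printed
counterpart NAMED ONLY: Nummelin 1978 / Athreya–Ney 1978 (splitting), Mykland–Tierney–Yu 1995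
(regenerative MCMC) — nothing is cited as a fact.

## Content

* **`regenerative_protocol_minorised`** — the existence-and-certificates statement above.

NOT CLAIMED: observability of the coins for a general kernel; optimal constants; a CLT.
-/

noncomputable section

namespace Summit.Ventures.LatticeQCDFlow.Scoring

open MeasureTheory ProbabilityTheory Filter Finset Preorder Literature.Probability.MarkovChains
open scoped ENNReal

variable {Ω : Type*} [MeasurableSpace Ω]

/-- **THE REGENERATIVE PROTOCOL OF A MINORISED EXACT SAMPLER.**  See the module docstring. -/
theorem regenerative_protocol_minorised {κ : Kernel Ω Ω} [IsMarkovKernel κ] {π ν : Measure Ω}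
    [IsProbabilityMeasure π] [IsProbabilityMeasure ν] {ε : ℝ≥0∞} (hπ : Kernel.Invariant κ π)
    (hmin : ∀ x {B : Set Ω}, MeasurableSet B → ε * ν B ≤ κ x B) (hε0 : 0 < ε) (hε : ε < 1) :
    ∃ κs : Kernel (Ω × Bool) (Ω × Bool), ∃ _ : IsMarkovKernel κs,
      -- (i) the state path of the `κ̂`-chain IS the `κ`-chain
      (∀ (μs : Measure (Ω × Bool)) [IsProbabilityMeasure μs],
        (Kernel.trajMeasure (X := fun _ : ℕ => Ω × Bool) μs
            (fun n : ℕ => κs.comap (fun h : (i : ↥(Finset.Iic n)) → Ω × Bool =>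
              h ⟨n, Finset.mem_Iic.2 le_rfl⟩) (measurable_pi_apply _))).map
            (fun (x : ℕ → Ω × Bool) (n : ℕ) => (x n).1)
          = Kernel.trajMeasure (X := fun _ : ℕ => Ω) (μs.map Prod.fst)
            (fun n : ℕ => κ.comap (fun h : (i : ↥(Finset.Iic n)) → Ω => h ⟨n, Finset.mem_Iic.2 le_rfl⟩)
              (measurable_pi_apply _))) ∧
      ∀ (μs : Measure (Ω × Bool)) [IsProbabilityMeasure μs] (f : Ω → ℝ), Measurable f →
        ∀ C : ℝ, (∀ x, |f x| ≤ C) → ∀ R : ℕ, 0 < R → ∀ s : ℝ, 0 < s →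
        -- (ii) the tour estimator at the CLT scale
        (Kernel.trajMeasure (X := fun _ : ℕ => Ω × Bool) μs
            (fun n : ℕ => κs.comap (fun h : (i : ↥(Finset.Iic n)) → Ω × Bool =>
              h ⟨n, Finset.mem_Iic.2 le_rfl⟩) (measurable_pi_apply _))).real
          {x | s ≤ |(∑ i ∈ Finset.range R, ∑' u, (if (∑ s ∈ Finset.range u,
                (if (x (s + 1)).2 then (1 : ℕ) else 0)) = i + 1 then (1 : ℝ) else 0) * f (x u).1)
              / (∑ i ∈ Finset.range R, ∑' u, (if (∑ s ∈ Finset.range u,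
                (if (x (s + 1)).2 then (1 : ℕ) else 0)) = i + 1 then (1 : ℝ) else 0))
              - ∫ z, f z ∂π|}
          ≤ 4 * (ε.toReal * ((∫ y, (f y - ∫ z, f z ∂π) ^ 2 ∂π)
              + 2 * ∑' k, ∫ y, (f y - ∫ z, f z ∂π)
                * (kop κ)^[k + 1] (fun y => f y - ∫ z, f z ∂π) y ∂π)
              / s ^ 2 + (1 - ε.toReal)) / R
        -- (iii) the median of tour groups at the CLT scale
        ∧ (∀ m : ℕ, 0 < m →
            4 * (ε.toReal * ((∫ y, (f y - ∫ z, f z ∂π) ^ 2 ∂π)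
              + 2 * ∑' k, ∫ y, (f y - ∫ z, f z ∂π)
                * (kop κ)^[k + 1] (fun y => f y - ∫ z, f z ∂π) y ∂π)
              / s ^ 2 + (1 - ε.toReal)) / m ≤ 1 / 4 →
            ∀ K : ℕ, (Kernel.trajMeasure (X := fun _ : ℕ => Ω × Bool) μs
              (fun n : ℕ => κs.comap (fun h : (i : ↥(Finset.Iic n)) → Ω × Bool =>
                h ⟨n, Finset.mem_Iic.2 le_rfl⟩) (measurable_pi_apply _))).real
            {x | (K : ℝ) / 2 ≤ ∑ k ∈ Finset.range K,
              (if s ≤ |(∑ i ∈ Finset.range m, ∑' u, (if (∑ s ∈ Finset.range u,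
                    (if (x (s + 1)).2 then (1 : ℕ) else 0)) = k * (m + 1) + i + 1 then (1 : ℝ) else 0)
                    * f (x u).1)
                  / (∑ i ∈ Finset.range m, ∑' u, (if (∑ s ∈ Finset.range u,
                    (if (x (s + 1)).2 then (1 : ℕ) else 0)) = k * (m + 1) + i + 1 then (1 : ℝ) else 0))
                  - ∫ z, f z ∂π| then (1 : ℝ) else 0)}
            ≤ Real.exp (-((K : ℝ) / 8)))
        -- (iv) the plug-in variance estimator
        ∧ (∀ a : ℝ, 0 < a → (Kernel.trajMeasure (X := fun _ : ℕ => Ω × Bool) μs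
              (fun n : ℕ => κs.comap (fun h : (i : ↥(Finset.Iic n)) → Ω × Bool =>
                h ⟨n, Finset.mem_Iic.2 le_rfl⟩) (measurable_pi_apply _))).real
            {x | a + 3 * (4 * C * s + s ^ 2) / ε.toReal ^ 2
              ≤ |(∑ i ∈ Finset.range R, ((∑' u, (if (∑ s ∈ Finset.range u,
                    (if (x (s + 1)).2 then (1 : ℕ) else 0)) = i + 1 then (1 : ℝ) else 0) * f (x u).1)
                  - ((∑ i ∈ Finset.range R, ∑' u, (if (∑ s ∈ Finset.range u,
                      (if (x (s + 1)).2 then (1 : ℕ) else 0)) = i + 1 then (1 : ℝ) else 0) * f (x u).1)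
                    / (∑ i ∈ Finset.range R, ∑' u, (if (∑ s ∈ Finset.range u,
                      (if (x (s + 1)).2 then (1 : ℕ) else 0)) = i + 1 then (1 : ℝ) else 0)))
                  * (∑' u, (if (∑ s ∈ Finset.range u, (if (x (s + 1)).2 then (1 : ℕ) else 0)) = i + 1
                    then (1 : ℝ) else 0))) ^ 2) / R
                - ∫ y, (∑' u, (if (∑ s ∈ Finset.range u, (if (y (s + 1)).2 then (1 : ℕ) else 0)) = 0
                  then (1 : ℝ) else 0) * (f (y u).1 - ∫ z, f z ∂π)) ^ 2
                  ∂(Kernel.trajMeasure (X := fun _ : ℕ => Ω × Bool) (ν.map (fun y : Ω => (y, true)))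
                    (fun n : ℕ => κs.comap (fun h : (i : ↥(Finset.Iic n)) → Ω × Bool =>
                      h ⟨n, Finset.mem_Iic.2 le_rfl⟩) (measurable_pi_apply _)))|}
            ≤ ((2 * C) ^ 4 * 24 / (ε.toReal ^ 4 * a ^ 2) + 24
                + 4 * ((2 - ε.toReal) * (2 * C) ^ 2 / s ^ 2 + (1 - ε.toReal))) / R) := by
  obtain ⟨κs, hκsM, hκs⟩ := exists_splitKernel (κ := κ) (ν := ν) (hmin := hmin) hε
  refine ⟨κs, hκsM, fun μs _ => splitChain_map_fst κs μs (κ := κ) (ν := ν) (hmin := hmin) hε hκs,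
    fun μs _ f hf C hC R hR s hs => ⟨?_, fun m hm hsmall K => ?_, fun a ha => ?_⟩⟩
  · exact regenerative_estimator_confidence_sigma κs μs (κ := κ) (ν := ν) (hmin := hmin) hπ hε0 hε
      hκs hf hC hR hs
  · exact regenerative_medianOfGroups_confidence_sigma κs μs (κ := κ) (ν := ν) (hmin := hmin) hπ hε0
      hε hκs hf hC hm hs hsmall K
  · exact regenerative_variance_plugIn_confidence κs μs (κ := κ) (ν := ν) (hmin := hmin) hπ hε0 hε
      hκs hf hC hR ha hs

end Summit.Ventures.LatticeQCDFlow.Scoring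

end
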